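import Literature.AnabelianGeometry.AbsoluteAnabelian.AbsAnabProp121viiNormalizedCharacter
import Literature.NumberTheory.GaloisRepresentations.LocalKummerTorsion
import HarnessLib

/-!
# [AbsAnab] Prop 1.2.1 (vii), sub-DAG row L10 `ColimitClause`: the characterised residue maps at
# levels `n ∣ N` are compatible with `μ_n ⊆ μ_N` (so they assemble to `H²(G_K, μ_{ℚ/ℤ}) → ℚ/ℤ`)

Proof-only companion of `AbsAnabProp121viiSub.lean` (abc-iut cell, D-0068 (1) full-M discharge;
layer L4; node `AbsAnab:Prop1.2.1(vii)`, sub-DAG `plan/L4/SUBDAG-AbsAnab-Prop121vii.md` row **L10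
`ColimitClause`** — "compatibility of `inv_{K,n}` with `μ_n ↪ μ_{nm}` … so that the level-`n`
statements give print's `μ_{ℚ/ℤ}` statement", recorded in words by the holder abc-iut-w5-d198;
also `plan/L4/SUBDAG-AbsTopIII-Prop32.md` row P32.i.L06 "at finite level: compatibility of
`mlf_H2_mu_equiv_zmod` in `n`").  S. Mochizuki, *The Absolute Anabelian Geometry of Hyperbolic
Curves* (2004) [AbsAnab], Prop 1.2.1 (vii) p. 11: the residue map is stated on
`H²(K, μ_{ℚ/ℤ}(K̄)) = colim_n H²(G_K, μ_n(K̄))` (p. 10, notation `μ_{ℚ/ℤ} = colim μ_n`); the tree types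
it at each finite level `n` through the characterisation `Prop121vii.IsInvariantMap K n inv`
(bijective `H²(G_K, μ_n) → ℤ/n` with `inv(κ_n(π) ∪ χ) = 1`).  PROVED HERE, as THEOREMS over that frozen
predicate (no new `Prop`, no definition):

* `Prop121vii.cohomologyMap_muInclHom_δ₀` — Kummer classes across levels:
  `H¹(μ_n ⊆ μ_{nm})(κ_n(u)) = m · κ_{nm}(u)` for every `G_K`-invariant `u ∈ K̄ˣ` (the lifts `w` and
  `m · w`, `δ₀_apply_eq`, injectivity of `μ_{nm} ↪ K̄ˣ`).
* `Prop121vii.cohomologyMap_muInclHom_cupProduct_scalarCocycle` — the evaluation cup product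
  `H¹(μ_n) × H¹(μ_n^∨(1)) → H²(μ_n)` across levels: for a cyclic character `ψ_N : G_K ↠ ℤ/N`
  (`N = nm`) with reduction `ψ_n`, `H²(⊆)(x ∪ [σ ↦ ψ_n(σ)·id]) = H¹(⊆)(x) ∪ [σ ↦ ψ_N(σ)·id]`
  (pointwise on inhomogeneous cocycles; the `n`-torsion of `μ_n ⊆ μ_N` absorbs `val mod n`).
* `Prop121vii.invariantMap_muInclHom_compat` — **row L10**: for `n ∣ N` and residue maps
  `inv_n`, `inv_N` with `IsInvariantMap K n inv_n`, `IsInvariantMap K N inv_N`,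
  `inv_N (H²(μ_n ⊆ μ_N) x) = (N/n) · inv_n x` (`ℤ/n ↪ ℤ/N`, `k ↦ (N/n) k`, i.e.
  `(1/n)ℤ/ℤ ⊆ (1/N)ℤ/ℤ`); and `Prop121vii.invariantMap_muInclHom_compat_addCircle`, the same read in
  `ℚ/ℤ = AddCircle (1 : ℚ)`: `inv_N(H²(⊆) x)/N = inv_n(x)/n`.  Proof: choose the witnesses the
  characterisation quantifies over — the normalised unramified character `ψ_N` of
  `exists_normalizedCharacter` (abc-iut-w5-d201) and its reduction `ψ_n`, a uniformiser `π` — so that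
  `inv_n(κ_n(π) ∪ [ψ_n]) = 1 = inv_N(κ_N(π) ∪ [ψ_N])` while `H²(⊆)` carries the first class to `m`
  times the second; `inv_n` bijective makes `κ_n(π) ∪ [ψ_n]` a generator.

Classical (Serre, *Local Fields* XIII §3 Prop. 7: `inv_K` is defined on `Br(K) = ⋃ H²(K_n/K)` compatibly
with the inclusions; XIV §1).  HONEST FRAMING: classical, undisputed homological algebra and local
class field theory; nothing here bears on [IUTchIII] Cor. 3.12; no side taken.

## References
* [SerreLocalFields1979] J.-P. Serre, *Local Fields*, GTM 67 (1979), XIII §3, XIV §1.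
* [MochizukiAbsAnab2004] S. Mochizuki, *The absolute anabelian geometry of hyperbolic curves* (2004),
  Prop 1.2.1 (vii) p. 11.
-/

noncomputable section

universe u

namespace Literature.AnabelianGeometry.AbsoluteAnabelian

open Field Function IntermediateField
open Literature.NumberTheory.GaloisRepresentations
open Literature.NumberTheory.GaloisRepresentations.DiscreteGaloisModule
open Literature.NumberTheory.GaloisRepresentations.LocalWeilDatum
open ValuativeRel

namespace Prop121vii

/-! ### §0. Arithmetic of `n`-torsion -/

section Torsion

/-- On an element killed by `n`, an integer multiple only depends on the multiplier modulo `n`: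
`(k mod n) · y = k · y`. [folklore] -/
private theorem natMod_zsmul_eq {M : Type*} [AddCommGroup M] {n : ℕ} (y : M) (hy : (n : ℤ) • y = 0)
    (k : ℕ) : ((k % n : ℕ) : ℤ) • y = (k : ℤ) • y := by
  have h : (k : ℤ) = ((k % n : ℕ) : ℤ) + ((k / n : ℕ) : ℤ) * (n : ℤ) := by
    conv_lhs => rw [← Nat.mod_add_div k n]
    push_cast
    ring
  rw [h, add_smul, mul_smul, hy, smul_zero, add_zero]

/-- The reduction `ℤ/N → ℤ/n` (`n ∣ N`) acting on an `n`-torsion element: `(a mod n).val · y = a.val · y`.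
[folklore] -/
private theorem castHom_val_zsmul_eq {M : Type*} [AddCommGroup M] {n N : ℕ} [NeZero n] [NeZero N]
    (hnN : n ∣ N) (y : M) (hy : (n : ℤ) • y = 0) (a : ZMod N) :
    (((ZMod.castHom hnN (ZMod n) a).val : ℤ)) • y = ((a.val : ℤ)) • y := by
  rw [ZMod.castHom_apply, ZMod.cast_eq_val, ZMod.val_natCast]
  exact natMod_zsmul_eq y hy a.val

end Torsion

/-! ### §1. Kummer classes across levels: `H¹(μ_n ⊆ μ_{nm}) κ_n = m · κ_{nm}` -/

section KummerLevel

variable (K : Type u) [Field K] {n m : ℕ}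

/-- Elements of `μ_n ⊆ μ_{nm}` are killed by `n`. [folklore] -/
private theorem zsmul_muInclusion_eq_zero [NeZero n] (h : n ∣ n * m) (v : MuCarrier K n) :
    (n : ℤ) • muInclusion K h v = 0 := by
  rw [← map_zsmul, zsmul_muCarrier_eq_zero, map_zero]

/-- **Kummer classes across levels.**  For a `G_K`-invariant `u ∈ K̄ˣ`, the image of its level-`n`
Kummer class `κ_n(u) = δ₀(u) ∈ H¹(G_K, μ_n)` under `H¹(μ_n ⊆ μ_{nm})` is `m · κ_{nm}(u)`: with `w` an
`nm`-th root of `u`, `m · w` is an `n`-th root, and `σ(m·w) − m·w = m·(σ w − w)` in `K̄ˣ`.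
[cite: SerreLocalFields1979, XIV §1] -/
theorem cohomologyMap_muInclHom_δ₀ [NeZero n] [NeZero m] (u : (units K).toTopRep.ρ.invariants) :
    cohomologyMap (muInclHom K (dvd_mul_right n m)) 1 ((isSES_kummer K n (NeZero.pos n)).δ₀ u) =
      m • (isSES_kummer K (n * m) (NeZero.pos _)).δ₀ u := by
  obtain ⟨w, hw⟩ := (isSES_kummer K (n * m) (NeZero.pos _)).surjective (u : UnitsCarrier K)
  have hw' : (kummerπ K n).hom (m • w) = (u : UnitsCarrier K) := by
    rw [kummerπ_hom_apply, ← natCast_zsmul, smul_smul, ← Nat.cast_mul, ← kummerπ_hom_apply, hw]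
  rw [(isSES_kummer K n (NeZero.pos n)).δ₀_apply_eq u (m • w) hw',
    (isSES_kummer K (n * m) (NeZero.pos _)).δ₀_apply_eq u w hw, cohomologyMap_oneCocycleClass,
    ← oneCocycleClassₗ_apply, ← oneCocycleClassₗ_apply, ← map_nsmul]
  have hwi : (kummerπ K (n * m)).hom w ∈ (units K).toTopRep.ρ.invariants := by rw [hw]; exact u.2
  have hwi' : (kummerπ K n).hom (m • w) ∈ (units K).toTopRep.ρ.invariants := by rw [hw']; exact u.2
  refine congrArg _ (Subtype.ext (ContinuousMap.ext fun σ => ?_))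
  apply (isSES_kummer K (n * m) (NeZero.pos _)).injective
  change (kummerι K (n * m)).hom ((muInclHom K (dvd_mul_right n m)).hom
      (((isSES_kummer K n (NeZero.pos n)).δ₀Cocycle (m • w) hwi').1 σ)) =
    (kummerι K (n * m)).hom (m • ((isSES_kummer K (n * m) (NeZero.pos _)).δ₀Cocycle w hwi).1 σ)
  rw [← kummerι_eq_kummerι_muInclHom, IsSES.f_δ₀Cocycle_apply, map_nsmul, map_nsmul,
    IsSES.f_δ₀Cocycle_apply, smul_sub]

end KummerLevel

/-! ### §2. The evaluation cup product across levels -/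

section CupLevel

variable (K : Type u) [Field K] {n m : ℕ}

/-- Pointwise subtraction in the Tate dual `Hom(μ_n, μ_n)`. [folklore] -/
private theorem tateDual_sub_apply (h h' : TateDual K (MuCarrier K n) n) (v : MuCarrier K n) :
    (h - h') v = h v - h' v := rfl

/-- **The evaluation cup product `H¹(μ_n) × H¹(μ_n^∨(1)) → H²(μ_n)` across levels.**  For a cyclic
character `ψ_N : G_K ↠ ℤ/N`, `N = nm`, and a cyclic character `ψ_n : G_K ↠ ℤ/n` with
`ψ_n = ψ_N mod n`, the crossed homomorphisms `σ ↦ ψ_n(σ)·id_{μ_n}`, `σ ↦ ψ_N(σ)·id_{μ_N}`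
(`scalarCocycle`) satisfy `H²(μ_n ⊆ μ_N)(x ∪ [ψ_n·id]) = H¹(μ_n ⊆ μ_N)(x) ∪ [ψ_N·id]` for every
`x ∈ H¹(G_K, μ_n)` — on inhomogeneous cocycles both sides are
`(σ, τ) ↦ (ψ_N(στ).val − ψ_N(σ).val) · f(σ)` read in `μ_N`, since `f(σ) ∈ μ_n` is `n`-torsion.
[cite: SerreLocalFields1979, XIV §1] -/
theorem cohomologyMap_muInclHom_cupProduct_scalarCocycle [NeZero n] [NeZero (n * m)]
    [Finite (MuCarrier K n)] [Finite (MuCarrier K (n * m))]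
    (ψN : CyclicCharacter (absoluteGaloisGroup K) (n * m))
    (ψn : CyclicCharacter (absoluteGaloisGroup K) n)
    (hψ : ∀ σ, ψn σ = ZMod.castHom (dvd_mul_right n m) (ZMod n) (ψN σ))
    (x : continuousCohomology 1 (mu K n).toTopRep) :
    haveI : CompactSpace (absoluteGaloisGroup K) := absoluteGaloisGroup_compactSpace K
    cohomologyMap (muInclHom K (dvd_mul_right n m)) 2
        (((mu K n).tateDualPairing n).cupProduct x (oneCocycleClass _ (scalarCocycle ψn))) =
      ((mu K (n * m)).tateDualPairing (n * m)).cupProduct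
        (cohomologyMap (muInclHom K (dvd_mul_right n m)) 1 x)
        (oneCocycleClass _ (scalarCocycle ψN)) := by
  haveI : CompactSpace (absoluteGaloisGroup K) := absoluteGaloisGroup_compactSpace K
  obtain ⟨f, rfl⟩ := oneCocycleClass_surjective _ x
  rw [ContPairing.cupProduct_oneCocycleClass_eq_twoCocycleClass, cohomologyMap_twoCocycleClass,
    cohomologyMap_oneCocycleClass, ContPairing.cupProduct_oneCocycleClass_eq_twoCocycleClass]
  refine congrArg (twoCocycleClass _) (Subtype.ext (ContinuousMap.ext fun p => ?_))
  obtain ⟨σ, τ⟩ := p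
  change (muInclHom K (dvd_mul_right n m)).hom
      (((scalarCocycle ψn).1 (σ * τ) - (scalarCocycle ψn).1 σ) (f.1 σ)) =
    ((scalarCocycle ψN).1 (σ * τ) - (scalarCocycle ψN).1 σ)
      ((muInclHom K (dvd_mul_right n m)).hom (f.1 σ))
  rw [tateDual_sub_apply, tateDual_sub_apply, scalarCocycle_apply, scalarCocycle_apply,
    scalarCocycle_apply, scalarCocycle_apply, muInclHom_hom_apply, hψ, hψ]
  change muInclusion K (dvd_mul_right n m)
      ((((ZMod.castHom (dvd_mul_right n m) (ZMod n) (ψN (σ * τ))).val : ℤ)) • f.1 σ -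
        (((ZMod.castHom (dvd_mul_right n m) (ZMod n) (ψN σ)).val : ℤ)) • f.1 σ) =
    (((ψN (σ * τ)).val : ℤ)) • muInclusion K (dvd_mul_right n m) (f.1 σ) -
      (((ψN σ).val : ℤ)) • muInclusion K (dvd_mul_right n m) (f.1 σ)
  rw [map_sub, map_zsmul, map_zsmul,
    castHom_val_zsmul_eq (dvd_mul_right n m) _ (zsmul_muInclusion_eq_zero K _ (f.1 σ)),
    castHom_val_zsmul_eq (dvd_mul_right n m) _ (zsmul_muInclusion_eq_zero K _ (f.1 σ))]

end CupLevel

/-! ### §3. Row L10: compatibility of the characterised residue maps across levels -/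

section Compat

variable (K : Type u) [Field K] [ValuativeRel K] [TopologicalSpace K] [IsNonarchimedeanLocalField K]

omit [ValuativeRel K] [TopologicalSpace K] [IsNonarchimedeanLocalField K] in
/-- A non-zero element `x` of the base field defines a `G_K`-invariant of `K̄ˣ` with value `x`.
[folklore] -/
private theorem exists_baseInvariant_of_ne_zero (x : K) (hx : x ≠ 0) :
    ∃ u : (units K).toTopRep.ρ.invariants,
      (unitsVal K (u : UnitsCarrier K) : AlgebraicClosure K) = algebraMap K (AlgebraicClosure K) x := by
  refine ⟨⟨UnitsCarrier.ofUnits (Units.mk0 (algebraMap K (AlgebraicClosure K) x)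
      ((map_ne_zero_iff _ (algebraMap K (AlgebraicClosure K)).injective).2 hx)), fun σ => ?_⟩, rfl⟩
  apply unitsVal_injective K
  rw [ContinuousRep.toTopRep_ρ_apply, unitsVal_apply, unitsVal_ofUnits]
  ext
  rw [Units.coe_smul, Units.val_mk0]
  exact σ.commutes x

/-- A uniformiser of the MLF `K` exists. [folklore] -/
private theorem exists_isUniformizer' : ∃ π : K, (valuation K).IsUniformizer π := by
  obtain ⟨ϖ, hϖ⟩ := IsDiscreteValuationRing.exists_irreducible 𝒪[K]
  have h0 : (ϖ : K) ≠ 0 := fun h => hϖ.ne_zero (Subtype.ext h)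
  exact ⟨ϖ, (ord_eq_one_iff K h0).1 (ord_eq_one_of_irreducible K hϖ)⟩

/-- **[AbsAnab] Prop 1.2.1 (vii), sub-DAG row L10 `ColimitClause` — PROVED (levels `n ∣ nm`).**  For an
MLF `K` (valued form, characteristic `0`) and the residue maps `inv_n : H²(G_K, μ_n) → ℤ/n`,
`inv_{nm} : H²(G_K, μ_{nm}) → ℤ/nm` characterised by `IsInvariantMap` (bijective,
`inv(κ(π) ∪ χ^unr) = 1`), the change of coefficients `μ_n ⊆ μ_{nm}` is intertwined with
`ℤ/n ↪ ℤ/nm`, `k ↦ m·k` (`= (1/n)ℤ/ℤ ⊆ (1/nm)ℤ/ℤ`): `inv_{nm}(H²(⊆) x) = m · inv_n(x)`.  Hence the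
level-`n` residue maps assemble to print's `H²(G_K, μ_{ℚ/ℤ}(K̄)) = colim_n H²(G_K, μ_n) ⥲ ℚ/ℤ`.
[cite: MochizukiAbsAnab2004, Prop 1.2.1 (vii) p.11] -/
theorem invariantMap_muInclHom_compat_mul [CharZero K] {n m : ℕ} [NeZero n] [NeZero (n * m)]
    [Finite (MuCarrier K n)] [Finite (MuCarrier K (n * m))]
    (invn : galoisCohomology (mu K n) 2 →+ ZMod n)
    (invN : galoisCohomology (mu K (n * m)) 2 →+ ZMod (n * m))
    (hn : IsInvariantMap K n invn) (hN : IsInvariantMap K (n * m) invN)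
    (x : galoisCohomology (mu K n) 2) :
    invN (cohomologyMap (muInclHom K (dvd_mul_right n m)) 2 x) = (((invn x).val * m : ℕ) : ZMod (n * m)) := by
  classical
  haveI : CompactSpace (absoluteGaloisGroup K) := absoluteGaloisGroup_compactSpace K
  haveI : NeZero m := ⟨fun h => NeZero.ne (n * m) (by rw [h, mul_zero])⟩
  rcases Nat.lt_or_ge 1 (n * m) with h1 | h1
  · -- the witnesses the characterisation quantifies over
    obtain ⟨ψN, hI, hF, -, -⟩ := exists_normalizedCharacter K (n * m) h1
    haveI : DiscreteTopology (ZMod (n * m)) := ⟨rfl⟩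
    let ψn : CyclicCharacter (absoluteGaloisGroup K) n :=
      { toFun := fun σ => ZMod.castHom (dvd_mul_right n m) (ZMod n) (ψN σ)
        map_mul' := fun σ τ => by simp only [ψN.map_mul, map_add]
        continuous_toFun := continuous_of_discreteTopology.comp ψN.continuous
        surjective' := (ZMod.ringHom_surjective (ZMod.castHom (dvd_mul_right n m) (ZMod n))).comp
          ψN.surjective }
    have hψn : ∀ σ, ψn σ = ZMod.castHom (dvd_mul_right n m) (ZMod n) (ψN σ) := fun _ => rfl
    have hgn : IsNormalizedUnramifiedCocycle K n (scalarCocycle ψn) :=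
      isNormalizedUnramifiedCocycle_scalarCocycle K ψn
        (fun σ hσ => by rw [hψn, hI σ hσ, map_zero]) (fun σ hσ => by rw [hψn, hF σ hσ, map_one])
    have hgN : IsNormalizedUnramifiedCocycle K (n * m) (scalarCocycle ψN) :=
      isNormalizedUnramifiedCocycle_scalarCocycle K ψN hI hF
    obtain ⟨π, hπ⟩ := exists_isUniformizer' K
    obtain ⟨u, hu⟩ := exists_baseInvariant_of_ne_zero K π hπ.ne_zero
    -- the two canonical classes and their invariants (the residue maps viewed on the carriers of `H²`)
    obtain ⟨hbij, hnormn⟩ := hn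
    obtain ⟨-, hnormN⟩ := hN
    let ιn : continuousCohomology 2 (mu K n).toTopRep →+ ZMod n := invn
    let ιN : continuousCohomology 2 (mu K (n * m)).toTopRep →+ ZMod (n * m) := invN
    have hbij' : Function.Bijective ιn := hbij
    have h1n : ιn (((mu K n).tateDualPairing n).cupProduct
        ((isSES_kummer K n (NeZero.pos n)).δ₀ u) (oneCocycleClass _ (scalarCocycle ψn))) = 1 :=
      hnormn _ hgn π hπ u hu
    have h1N : ιN (((mu K (n * m)).tateDualPairing (n * m)).cupProduct
        ((isSES_kummer K (n * m) (NeZero.pos _)).δ₀ u) (oneCocycleClass _ (scalarCocycle ψN))) = 1 :=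
      hnormN _ hgN π hπ u hu
    suffices h : ∀ y : continuousCohomology 2 (mu K n).toTopRep,
        ιN (cohomologyMap (muInclHom K (dvd_mul_right n m)) 2 y) = (((ιn y).val * m : ℕ) : ZMod (n * m)) from
      h x
    intro y
    -- `H²(⊆)` carries the first to `m` times the second
    have key : cohomologyMap (muInclHom K (dvd_mul_right n m)) 2
        (((mu K n).tateDualPairing n).cupProduct
          ((isSES_kummer K n (NeZero.pos n)).δ₀ u) (oneCocycleClass _ (scalarCocycle ψn))) =
        m • ((mu K (n * m)).tateDualPairing (n * m)).cupProduct
          ((isSES_kummer K (n * m) (NeZero.pos _)).δ₀ u) (oneCocycleClass _ (scalarCocycle ψN)) := by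
      rw [cohomologyMap_muInclHom_cupProduct_scalarCocycle K ψN ψn hψn, cohomologyMap_muInclHom_δ₀,
        map_nsmul, LinearMap.smul_apply]
    -- the first class generates `H²(G_K, μ_n)` (`inv_n` is a bijection sending it to `1`)
    have hy : y = (((ιn y).val : ℤ)) • ((mu K n).tateDualPairing n).cupProduct
        ((isSES_kummer K n (NeZero.pos n)).δ₀ u) (oneCocycleClass _ (scalarCocycle ψn)) := by
      apply hbij'.injective
      rw [map_zsmul, h1n, zsmul_one, Int.cast_natCast, ZMod.natCast_zmod_val]
    conv_lhs => rw [hy]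
    rw [map_zsmul, key, map_zsmul, map_nsmul, h1N, nsmul_one, zsmul_eq_mul, Int.cast_natCast,
      Nat.cast_mul]
  · -- the degenerate case `nm = 1`
    have hnm : n * m = 1 := le_antisymm h1 (Nat.one_le_iff_ne_zero.2 (NeZero.ne _))
    haveI : Subsingleton (ZMod (n * m)) := by rw [hnm]; infer_instance
    exact Subsingleton.elim _ _

/-- **Row L10 `ColimitClause`, divisibility form** (`n ∣ N`): `inv_N(H²(μ_n ⊆ μ_N) x) = (N/n) · inv_n(x)`
in `ℤ/N`. [cite: MochizukiAbsAnab2004, Prop 1.2.1 (vii) p.11] -/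
theorem invariantMap_muInclHom_compat [CharZero K] {n N : ℕ} [NeZero n] [NeZero N]
    [Finite (MuCarrier K n)] [Finite (MuCarrier K N)] (hnN : n ∣ N)
    (invn : galoisCohomology (mu K n) 2 →+ ZMod n) (invN : galoisCohomology (mu K N) 2 →+ ZMod N)
    (hn : IsInvariantMap K n invn) (hN : IsInvariantMap K N invN) (x : galoisCohomology (mu K n) 2) :
    invN (cohomologyMap (muInclHom K hnN) 2 x) = (((invn x).val * (N / n) : ℕ) : ZMod N) := by
  obtain ⟨m, rfl⟩ := hnN
  rw [Nat.mul_div_cancel_left m (NeZero.pos n)]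
  exact invariantMap_muInclHom_compat_mul K invn invN hn hN x

/-- **Row L10 `ColimitClause`, `ℚ/ℤ`-form**: reading `inv_n` in `(1/n)ℤ/ℤ ⊆ ℚ/ℤ` (`k ↦ k/n`, `ℚ/ℤ` as
Mathlib's `AddCircle (1 : ℚ)`), the residue maps of levels `n ∣ N` agree along `H²(μ_n ⊆ μ_N)`:
`inv_N(H²(⊆) x)/N = inv_n(x)/n` — i.e. they define one map on `colim_n H²(G_K, μ_n) = H²(G_K, μ_{ℚ/ℤ}(K̄))`,
print's residue map `H²(K, μ_{ℚ/ℤ}(K̄)) ⥲ ℚ/ℤ`. [cite: MochizukiAbsAnab2004, Prop 1.2.1 (vii) p.11] -/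
theorem invariantMap_muInclHom_compat_addCircle [CharZero K] {n N : ℕ} [NeZero n] [NeZero N]
    [Finite (MuCarrier K n)] [Finite (MuCarrier K N)] (hnN : n ∣ N)
    (invn : galoisCohomology (mu K n) 2 →+ ZMod n) (invN : galoisCohomology (mu K N) 2 →+ ZMod N)
    (hn : IsInvariantMap K n invn) (hN : IsInvariantMap K N invN) (x : galoisCohomology (mu K n) 2) :
    ((((invN (cohomologyMap (muInclHom K hnN) 2 x)).val : ℚ) / N : ℚ) : AddCircle (1 : ℚ)) =
      ((((invn x).val : ℚ) / n : ℚ) : AddCircle (1 : ℚ)) := by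
  obtain ⟨m, rfl⟩ := hnN
  haveI : NeZero m := ⟨fun h => NeZero.ne (n * m) (by rw [h, mul_zero])⟩
  have hval : (invN (cohomologyMap (muInclHom K (Dvd.intro m rfl)) 2 x)).val = (invn x).val * m := by
    rw [invariantMap_muInclHom_compat_mul K invn invN hn hN x, ZMod.val_natCast]
    exact Nat.mod_eq_of_lt (Nat.mul_lt_mul_of_lt_of_le (ZMod.val_lt _) le_rfl (NeZero.pos m))
  rw [hval]
  congr 1
  have hn0 : (n : ℚ) ≠ 0 := Nat.cast_ne_zero.2 (NeZero.ne n)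
  have hm0 : (m : ℚ) ≠ 0 := Nat.cast_ne_zero.2 (NeZero.ne m)
  push_cast
  field_simp

end Compat

end Prop121vii

end Literature.AnabelianGeometry.AbsoluteAnabelian

end
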